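import Literature.NumberTheory.Sieve.Maynard2016Lemma93ErrorBound
import HarnessLib

/-!
# Maynard 2016, proof of Lemma 9.3 — the main term as `P' · P · emSum` (left side of (9.29))

Sources: J. Maynard, *Dense clusters of primes in subsets*, Compositio Math. 152 (2016) 1517–1554 =
arXiv:1405.2593 [Maynard2016DenseClusters], proof of Lemma 9.3, p. 24 (displays (9.27)–(9.29): the main term
`(r/φ_L(r)) ∑_{e_m} (y_{r'}/φ_ω(e_m)) ∑*_{s,t} μ(s)/(φ(s)φ_ω(st))`, the Euler product (9.28), and the sum over
`e_m` «`(e_m, rW_m) = 1`» to which Lemma 8.3 is applied in (9.29)); K. Ford, B. Green, S. Konyagin, J. Maynard,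
T. Tao, *Long gaps between primes*, JAMS 31 (2018) [FordGreenKonyaginMaynardTao2018], §7 (7.8), Thm 6 (7.13).

With the exact skeleton `FGKMT2018.yVarM_eq_main_add_err` (`Maynard2016Lemma93MainSkeleton`), the `c`-free form
`FGKMT2018.eulerProd_update_div_phiOmega_eq` (`Maynard2016Lemma93CFree`) and the modulus bridge
`FGKMT2018.update_mem_admBox_iff` / `FGKMT2018.inv_prod_eq_emWeight` (`Maynard2016Lemma93EmModulus`), this file
identifies the MAIN part of `y^{(m)}_r` with the tree's `e_m`-sum `MaynardDense.emSum` of (9.29):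

* `sum_emWeight_F_eq_emSum`: the range identity
  `∑_{c ∣ ⌊R⌋#, r[m↦c] ∈ admBox} emWeight(c) F(u(r); u_m := log c/log R) = emSum (a_m WB ∏r W_m) ω (F-fibre) R`
  (the divisors `c ≥ R` carry `F = 0`, the `e < ⌈R⌉` outside the range carry `emWeight = 0`);
* `mainM_eq_emSum`: `MAIN(r) = (∏r/φ_L(∏r)) · P' · P · emSum (a_m WB ∏r W_m) ω (t ↦ F(u(r); u_m := t)) R` with
  `P' = ∏_{p ≤ ⌊R⌋} Λ_p(∏ r)` and `P = (WB)^k 𝔖_{WB}/φ(WB)^k`; together with `FGKMT2018.eulerProd_eq_emEuler_mul`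
  (`P' = emEuler · W_m/φ(W_m)`) and `MaynardDense.emSummation` this is display (9.29).

No new definitions, no named facts.

## References
* J. Maynard, *Dense clusters of primes in subsets*, Compositio Math. 152 (2016), proof of Lemma 9.3 p. 24,
  (9.27)–(9.29) [Maynard2016DenseClusters].
* K. Ford, B. Green, S. Konyagin, J. Maynard, T. Tao, *Long gaps between primes*, JAMS 31 (2018), §7 (7.8),
  Thm 6 (7.13) [FordGreenKonyaginMaynardTao2018].
-/

noncomputable section

open Finset
open scoped Nat

namespace Literature.NumberTheory.Sieve

namespace FGKMT2018

variable {k : ℕ}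

/-- **The range identity of the `e_m`-sum**: for `r ∈ 𝒟'^{(m)}_k` and `R > 1`,
`∑_{c ∣ ⌊R⌋#, r[m↦c] ∈ admBox} emWeight(a_m WB ∏r W_m, ω, c) · F_k(u(r); u_m := log c/log R)
 = emSum (a_m WB ∏r W_m) ω (t ↦ F_k(u(r); u_m := t)) R`:
the divisors `c ≥ R` have `F = 0` (coordinate `u_m ≥ 1`), and the `e < ⌈R⌉` that are not admissible have
`emWeight = 0` (admissible `↔` square-free and coprime to the modulus, `FGKMT2018.update_mem_admBox_iff`).
[cite: Maynard2016DenseClusters, proof of Lemma 9.3 p. 24, (9.27)–(9.29) (the sum over e_m, «(e_m, rW_m) = 1»)] -/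
theorem sum_emWeight_F_eq_emSum {L : Fin k → ℤ × ℤ} (hadm : FormsAdmissible L) {B : ℕ}
    {R : ℝ} (hR : 1 < R) {m : Fin k} {r : Fin k → ℕ} (hr : r ∈ dkBoxP L B R m) :
    ∑ c ∈ (primorial ⌊R⌋₊).divisors.filter (fun c => Function.update r m c ∈ admBox L B R),
        MaynardDense.emWeight (emModulus L B (primorial ⌊R⌋₊) m (∏ i, r i)) (omegaL L) c *
          MaynardDense.F k (Function.update (logVec R r) m (Real.log c / Real.log R)) =
      MaynardDense.emSum (emModulus L B (primorial ⌊R⌋₊) m (∏ i, r i)) (omegaL L)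
        (fun t => MaynardDense.F k (Function.update (logVec R r) m t)) R := by
  classical
  have hN : primorial ⌊R⌋₊ ≠ 0 := primorial_ne_zero _
  have hr1 : ∀ i, 1 ≤ r i := one_le_of_mem_dkBox (dkBoxP_subset L B R m hr)
  have hlogR : 0 < Real.log R := Real.log_pos hR
  have hu : logVec R r ∈ MaynardDense.orthant k := logVec_mem_orthant hR.le r hr1
  set M := emModulus L B (primorial ⌊R⌋₊) m (∏ i, r i) with hMdef
  set S := (primorial ⌊R⌋₊).divisors.filter (fun c => Function.update r m c ∈ admBox L B R) with hSdef
  set g : ℕ → ℝ := fun c => MaynardDense.emWeight M (omegaL L) c *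
    MaynardDense.F k (Function.update (logVec R r) m (Real.log c / Real.log R)) with hgdef
  unfold MaynardDense.emSum
  show ∑ c ∈ S, g c = ∑ e ∈ Finset.Ico 1 ⌈R⌉₊, g e
  -- both sums equal the sum over `S ∩ {c < R} = Ico 1 ⌈R⌉ ∩ S`
  have hT : S.filter (fun c : ℕ => (c : ℝ) < R) = (Finset.Ico 1 ⌈R⌉₊).filter (fun e => e ∈ S) := by
    ext c
    simp only [Finset.mem_filter, Finset.mem_Ico]
    constructor
    · rintro ⟨hcS, hcR⟩
      have hcd := (Finset.mem_filter.1 hcS).1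
      exact ⟨⟨Nat.pos_of_mem_divisors hcd, Nat.lt_ceil.2 hcR⟩, hcS⟩
    · rintro ⟨⟨-, hcR⟩, hcS⟩
      exact ⟨hcS, Nat.lt_ceil.1 hcR⟩
  have h1 : ∑ c ∈ S, g c = ∑ c ∈ S.filter (fun c : ℕ => (c : ℝ) < R), g c := by
    rw [Finset.sum_filter (s := S) (p := fun c : ℕ => (c : ℝ) < R)]
    refine Finset.sum_congr rfl fun c hc => ?_
    split_ifs with hcR
    · rfl
    · -- `c ≥ R`: `F = 0`
      have hcR' : R ≤ (c : ℝ) := not_lt.1 hcR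
      have hc1 : (1 : ℝ) ≤ c := by exact_mod_cast Nat.pos_of_mem_divisors (Finset.mem_filter.1 hc).1
      have hm : 1 ≤ Function.update (logVec R r) m (Real.log c / Real.log R) m := by
        rw [Function.update_self, le_div_iff₀ hlogR, one_mul]
        exact Real.log_le_log (by linarith) hcR'
      simp only [hgdef]
      rw [F_eq_zero_of_one_le (MaynardDense.update_mem_orthant hu m
        (div_nonneg (Real.log_nonneg hc1) hlogR.le)) m hm, mul_zero]
  have h2 : ∑ e ∈ Finset.Ico 1 ⌈R⌉₊, g e = ∑ e ∈ (Finset.Ico 1 ⌈R⌉₊).filter (fun e => e ∈ S), g e := by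
    rw [Finset.sum_filter (s := Finset.Ico 1 ⌈R⌉₊) (p := fun e => e ∈ S)]
    refine Finset.sum_congr rfl fun e he => ?_
    split_ifs with heS
    · rfl
    · -- `e ∉ S`: `emWeight = 0`
      obtain ⟨he1, heR⟩ := Finset.mem_Ico.1 he
      have hnot : ¬ (Squarefree e ∧ Nat.Coprime e M) := by
        rintro ⟨hsq, hcop⟩
        apply heS
        have heN : e ∣ primorial ⌊R⌋₊ := by
          -- a square-free `e ≤ ⌊R⌋` divides `⌊R⌋#` (cf. `Maynard2016.dvd_primorial_of_squarefree_le`)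
          have hen : e ≤ ⌊R⌋₊ := Nat.le_floor (Nat.lt_ceil.1 heR).le
          rw [← Nat.prod_primeFactors_of_squarefree hsq]
          refine Finset.prod_primes_dvd _ (fun p hp => (Nat.prime_of_mem_primeFactors hp).prime)
            fun p hp => ?_
          have hpp := Nat.prime_of_mem_primeFactors hp
          exact hpp.dvd_primorial_iff.2
            ((Nat.le_of_dvd hsq.ne_zero.bot_lt (Nat.dvd_of_mem_primeFactors hp)).trans hen)
        exact Finset.mem_filter.2 ⟨Nat.mem_divisors.2 ⟨heN, hN⟩,
          (update_mem_admBox_iff hadm hr e).2 ⟨heN, hcop⟩⟩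
      simp only [hgdef]
      rw [MaynardDense.emWeight_of_not (omegaL L) hnot, zero_mul]
  rw [h1, h2, hT]

/-- **The main term of Lemma 9.3 as the left side of (9.29)**: for `r ∈ 𝒟'^{(m)}_k` and `R > 1`,
`(∏r/φ_L(∏r)) ∑_{c} (y_{r[m↦c]}/φ_ω(c)) ∏_{p ≤ ⌊R⌋} Λ_p(∏ r[m↦c])
 = (∏r/φ_L(∏r)) · P' · P · emSum (a_m WB ∏r W_m) ω (t ↦ F_k(u(r); u_m := t)) R`,
`P' = ∏_{p ≤ ⌊R⌋} Λ_p(∏ r)` (`= emEuler · W_m/φ(W_m)`, `FGKMT2018.eulerProd_eq_emEuler_mul`), `P = (WB)^k𝔖_{WB}/φ(WB)^k`.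
[cite: Maynard2016DenseClusters, proof of Lemma 9.3 p. 24, (9.27)–(9.29)] -/
theorem mainM_eq_emSum {L : Fin k → ℤ × ℤ} (hadm : FormsAdmissible L) {B : ℕ} {R : ℝ}
    (hR : 1 < R) {m : Fin k} {r : Fin k → ℕ} (hr : r ∈ dkBoxP L B R m) :
    ((∏ i, r i : ℕ) : ℝ) / totForm (L m) (∏ i, r i) *
        ∑ c ∈ (primorial ⌊R⌋₊).divisors.filter (fun c => Function.update r m c ∈ admBox L B R),
          yVar L B R (MaynardDense.F k) (Function.update r m c) / phiOmega L c *
            ∏ p ∈ (primorial ⌊R⌋₊).primeFactors,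
              eulerFactorM L B m (∏ i, Function.update r m c i)
                (fun p j => sPrimeM L m j p / ((p : ℝ) - omegaL L p)) p =
      ((∏ i, r i : ℕ) : ℝ) / totForm (L m) (∏ i, r i) *
        (∏ p ∈ (primorial ⌊R⌋₊).primeFactors,
          eulerFactorM L B m (∏ i, r i) (fun p j => sPrimeM L m j p / ((p : ℝ) - omegaL L p)) p) *
        yPref L B *
        MaynardDense.emSum (emModulus L B (primorial ⌊R⌋₊) m (∏ i, r i)) (omegaL L)
          (fun t => MaynardDense.F k (Function.update (logVec R r) m t)) R := by
  classical
  rw [← sum_emWeight_F_eq_emSum hadm hR hr]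
  set S := (primorial ⌊R⌋₊).divisors.filter (fun c => Function.update r m c ∈ admBox L B R) with hSdef
  set P' := ∏ p ∈ (primorial ⌊R⌋₊).primeFactors,
      eulerFactorM L B m (∏ i, r i) (fun p j => sPrimeM L m j p / ((p : ℝ) - omegaL L p)) p with hP'def
  have hterm : ∀ c ∈ S,
      yVar L B R (MaynardDense.F k) (Function.update r m c) / phiOmega L c *
          ∏ p ∈ (primorial ⌊R⌋₊).primeFactors,
            eulerFactorM L B m (∏ i, Function.update r m c i)
              (fun p j => sPrimeM L m j p / ((p : ℝ) - omegaL L p)) p =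
        P' * (yPref L B *
          (MaynardDense.emWeight (emModulus L B (primorial ⌊R⌋₊) m (∏ i, r i)) (omegaL L) c *
            MaynardDense.F k (Function.update (logVec R r) m (Real.log c / Real.log R)))) := by
    intro c hc
    obtain ⟨-, hadmc⟩ := Finset.mem_filter.1 hc
    obtain ⟨hcN, hcop⟩ := (update_mem_admBox_iff hadm hr c).1 hadmc
    have hr'1 : ∀ i, 1 ≤ Function.update r m c i := one_le_of_mem_admBox hadmc
    have hy : yVar L B R (MaynardDense.F k) (Function.update r m c) =
        yPref L B * MaynardDense.F k (Function.update (logVec R r) m (Real.log c / Real.log R)) := by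
      rw [yVar_eq_mul_F L B hR.le _ hr'1, ← logVec_update_eq]
      rfl
    rw [div_mul_eq_mul_div, mul_div_assoc, eulerProd_update_div_phiOmega_eq hadm hr hadmc,
      inv_prod_eq_emWeight hadm hcN hcop, hy]
    ring
  rw [Finset.sum_congr rfl hterm, ← Finset.mul_sum, ← Finset.mul_sum]
  ring

end FGKMT2018

end Literature.NumberTheory.Sieve
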